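import Summits.PneNP.PneNP.Theorems.KarlinRubinMonotoneSufficesDecompCensusSlice

/-!
# Crux `MonotoneSuffices` (stmt-PneNP-18026, route KarlinRubin) — decomposition census r1, part 3: the other typed splits

Part of the DECOMPOSITION r1 audit of the crux (2026-08-17): canonical census
`Cruxes/MonotoneSuffices/STRATEGY-CENSUS.md` (planner-cstrat-stmt-PneNP-18026-r1-0, workfile `DecompositionAudit.lean`) and
the second-seat addendum (item evidence `STRATEGY-CENSUS-r1b.md`, planner-rtask-PneNP-KarlinRubin-kr-decomp-r1-64ab4eaa-0,
this file's author; the two seats were staffed on the same coordinator instruction and converged independently). Helpers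
`--supports stmt-PneNP-18026`; every theorem is a COMPOSITION of landed tree theorems; nothing here is new mathematics —
the files exist so that the census's `strategy: no-strategy` line points at kernel-checked implications instead of prose.

Signatures + PROVED glue for the remaining candidate splits of the census table: F2 (factorisation through a negation
budget `b n`: `MonotoneSuffices ↔ NegReduce b ∧ NegElim b` for EVERY `b`), F3 (the purely monotone rewording `SliceLift`,
glue both ways modulo the transports), F4 (`WeakFromStrong ∧ MonoAmp`), F5 (the vacuity split, glue = the landed sandwich).
Their statuses (which piece is the crux reworded / the summit in costume, and why no open piece has a plan) are in the census.
-/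

set_option linter.dupNamespace false -- `Summit.PneNP.PneNP.…`: summit = sub-problem name (D-0017 single-conjunct layout)

namespace Summit.PneNP.PneNP.Theorems

open Filter Topology Finset
open scoped Classical ENNReal
open Literature.Computability.Complexity Literature.Probability.RandomGraphs.PlantedClique
open Summit.PneNP.PneNP.Theses.KarlinRubin

/-! ## §4 The other typed splits examined (signatures + PROVED glue; statuses in STRATEGY-CENSUS.md §Decomposition)

Vocabulary: `HypB2 δ s` / `ConclMono δ s` are the hypothesis / conclusion shapes of the crux at exponent `δ` and
budget `s` (so `MonotoneSuffices ↔ ∀ δ ∈ (0,1/2) ∃ a ∀ s, HypB2 δ s → ConclMono δ (s+n)^a`, `Iff.rfl`). -/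

namespace MonotoneSuffices.DecompCensus

/-- Hypothesis shape of the crux: a strongly detecting `B₂` family of size `≤ s n`. -/
def HypB2 (δ : ℝ) (s : ℕ → ℕ) : Prop :=
  ∃ C : (n : ℕ) → Circuit ((⊤ : SimpleGraph (Fin n)).edgeSet),
    (∀ᶠ n : ℕ in atTop, (C n).IsOver B2 ∧ (C n).size ≤ s n) ∧ Tendsto (errSum (kOf δ) C) atTop (nhds 0)

/-- Conclusion shape of the crux: a strongly detecting `{∧₂,∨₂,0,1}` family of size `≤ s n`. -/
def ConclMono (δ : ℝ) (s : ℕ → ℕ) : Prop :=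
  ∃ M : (n : ℕ) → Circuit ((⊤ : SimpleGraph (Fin n)).edgeSet),
    (∀ᶠ n : ℕ in atTop, (M n).IsOver monotoneBasis01 ∧ (M n).size ≤ s n) ∧
      Tendsto (errSum (kOf δ) M) atTop (nhds 0)

/-- The crux in this vocabulary (definitional). -/
theorem monotoneSuffices_iff_hyp_concl :
    MonotoneSuffices ↔ ∀ δ : ℝ, 0 < δ → δ < 1 / 2 → ∃ a : ℕ, ∀ s : ℕ → ℕ,
      HypB2 δ s → ConclMono δ (fun n => (s n + n) ^ a) :=
  Iff.rfl

/-- `((s+n)^a₁ + n)^a₂ ≤ (s+n)^{(a₁+2) a₂}` for `n ≥ 2` (composition of two polynomial overheads). [folklore] -/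
theorem pow_add_pow_le (s n a₁ a₂ : ℕ) (hn2 : 2 ≤ n) :
    ((s + n) ^ a₁ + n) ^ a₂ ≤ (s + n) ^ ((a₁ + 2) * a₂) := by
  set q := s + n with hq
  have hq2 : 2 ≤ q := le_add_left hn2
  have hq1 : 1 ≤ q := by omega
  have h1 : q ^ a₁ + n ≤ q ^ (a₁ + 2) := by
    calc q ^ a₁ + n ≤ q ^ (a₁ + 1) + q ^ (a₁ + 1) :=
          Nat.add_le_add (Nat.pow_le_pow_right hq1 (by omega))
            ((Nat.le_add_left n s).trans (by
              calc q = q ^ 1 := (pow_one q).symm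
                _ ≤ q ^ (a₁ + 1) := Nat.pow_le_pow_right hq1 (by omega)))
      _ = 2 * q ^ (a₁ + 1) := by ring
      _ ≤ q * q ^ (a₁ + 1) := Nat.mul_le_mul_right _ hq2
      _ = q ^ (a₁ + 2) := by ring
  calc (q ^ a₁ + n) ^ a₂ ≤ (q ^ (a₁ + 2)) ^ a₂ := Nat.pow_le_pow_left h1 a₂
    _ = q ^ ((a₁ + 2) * a₂) := by rw [← pow_mul]

/-! ### F2 — factorisation through a NEGATION BUDGET `b n` (`B₂ → ≤ b n NOT gates → monotone`) -/

/-- `{∧₂, ∨₂, 0, 1} ⊆ {∧₂, ∨₂, ¬, 0, 1}`. [folklore] -/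
theorem monotoneBasis01_subset_deMorganBasis01 : monotoneBasis01 ⊆ deMorganBasis01 := by
  intro g hg
  simp only [monotoneBasis01, Set.mem_insert_iff] at hg
  rcases hg with rfl | rfl | hg
  · exact const_mem_deMorganBasis01 true
  · exact const_mem_deMorganBasis01 false
  · exact deMorganBasis_subset_deMorganBasis01 (monotoneBasis_subset_deMorgan hg)

/-- `{∧₂, ∨₂, ¬, 0, 1} ⊆ B₂`. [folklore] -/
theorem deMorganBasis01_subset_B2 : deMorganBasis01 ⊆ B2 := by
  intro g hg
  simp only [deMorganBasis01, Set.mem_insert_iff] at hg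
  rcases hg with rfl | rfl | hg
  · show (GateFn.const true).1 ≤ 2
    exact Nat.zero_le 2
  · show (GateFn.const false).1 ≤ 2
    exact Nat.zero_le 2
  · exact deMorganBasis_subset_B2 hg

/-- A circuit over `{∧₂, ∨₂, 0, 1}` has no NOT gates. [folklore] -/
theorem negationCount_eq_zero_of_isOver_monotoneBasis01 {ι : Type*} {C : Circuit ι}
    (hC : C.IsOver monotoneBasis01) : C.negationCount = 0 := by
  rw [Circuit.negationCount_eq, Circuit.sizeWith]
  refine List.sum_eq_zero fun w hw => ?_
  obtain ⟨g, hg, rfl⟩ := List.mem_map.1 hw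
  have hg' := hC g hg
  simp only [monotoneBasis01, monotoneBasis, Set.mem_insert_iff, Set.mem_singleton_iff] at hg'
  rcases hg' with h | h | h | h <;> simp [h]

/-- The intermediate model of F2: a strongly detecting family over `{∧₂,∨₂,¬,0,1}` with at most `b n` NOT gates and
size `≤ s n`. -/
def NegLimited (b : ℕ → ℕ) (δ : ℝ) (s : ℕ → ℕ) : Prop :=
  ∃ C : (n : ℕ) → Circuit ((⊤ : SimpleGraph (Fin n)).edgeSet),
    (∀ᶠ n : ℕ in atTop, (C n).IsOver deMorganBasis01 ∧ (C n).negationCount ≤ b n ∧ (C n).size ≤ s n) ∧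
      Tendsto (errSum (kOf δ) C) atTop (nhds 0)

/-- **F2 piece 1, `NegReduce b`**: partial monotonisation of a strong detector down to `b n` NOT gates at polynomial
cost (for `b n = ⌈log₂(C(n,2)+1)⌉` this is Fischer's theorem; for `b = 0` it is the crux). -/
def NegReduce (b : ℕ → ℕ) : Prop :=
  ∀ δ : ℝ, 0 < δ → δ < 1 / 2 → ∃ a : ℕ, ∀ s : ℕ → ℕ, HypB2 δ s → NegLimited b δ (fun n => (s n + n) ^ a)

/-- **F2 piece 2, `NegElim b`**: the last `b n` NOT gates of a strong detector are eliminable at polynomial cost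
(for `b n = ⌈log₂(C(n,2)+1)⌉` this is the crux by Fischer; for `b = 0` it is trivial). -/
def NegElim (b : ℕ → ℕ) : Prop :=
  ∀ δ : ℝ, 0 < δ → δ < 1 / 2 → ∃ a : ℕ, ∀ s : ℕ → ℕ, NegLimited b δ s → ConclMono δ (fun n => (s n + n) ^ a)

/-- **Glue of F2 (proved)**: `NegReduce b → NegElim b → MonotoneSuffices`, for every budget `b`. [folklore] -/
theorem monotoneSuffices_of_negSplit (b : ℕ → ℕ) (h₁ : NegReduce b) (h₂ : NegElim b) : MonotoneSuffices := by
  intro δ hδ hδ'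
  obtain ⟨a₁, ha₁⟩ := h₁ δ hδ hδ'
  obtain ⟨a₂, ha₂⟩ := h₂ δ hδ hδ'
  refine ⟨(a₁ + 2) * a₂, fun s hyp => ?_⟩
  obtain ⟨M, hM, hMerr⟩ := ha₂ _ (ha₁ s hyp)
  refine ⟨M, ?_, hMerr⟩
  filter_upwards [hM, eventually_ge_atTop 2] with n hn hn2
  exact ⟨hn.1, hn.2.trans (pow_add_pow_le (s n) n a₁ a₂ hn2)⟩

/-- **Converse (proved)**: the crux gives both F2 pieces, for every budget `b` — so `{NegReduce b, NegElim b}` is a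
genuine factorisation of `MonotoneSuffices` (jointly equivalent), not a weakening. [folklore] -/
theorem negSplit_of_monotoneSuffices (b : ℕ → ℕ) (h : MonotoneSuffices) : NegReduce b ∧ NegElim b := by
  constructor
  · intro δ hδ hδ'
    obtain ⟨a, ha⟩ := h δ hδ hδ'
    refine ⟨a, fun s hyp => ?_⟩
    obtain ⟨M, hM, hMerr⟩ := ha s hyp
    refine ⟨M, ?_, hMerr⟩
    filter_upwards [hM] with n hn
    exact ⟨hn.1.mono monotoneBasis01_subset_deMorganBasis01,
      (negationCount_eq_zero_of_isOver_monotoneBasis01 hn.1).le.trans (Nat.zero_le _), hn.2⟩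
  · intro δ hδ hδ'
    obtain ⟨a, ha⟩ := h δ hδ hδ'
    refine ⟨a, fun s hyp => ?_⟩
    obtain ⟨C, hC, hCerr⟩ := hyp
    exact ha s ⟨C, hC.mono fun n hn => ⟨hn.1.mono deMorganBasis01_subset_B2, hn.2.2⟩, hCerr⟩

/-- `MonotoneSuffices ↔ NegReduce b ∧ NegElim b`. [folklore] -/
theorem monotoneSuffices_iff_negSplit (b : ℕ → ℕ) : MonotoneSuffices ↔ NegReduce b ∧ NegElim b :=
  ⟨negSplit_of_monotoneSuffices b, fun h => monotoneSuffices_of_negSplit b h.1 h.2⟩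

/-! ### F3 — the purely monotone reformulation `SliceLift` (`slice-conditional monotone detection lifts`) -/

/-- **F3 piece `SliceLift`**: a `{∧₂,∨₂}` family that strongly detects CONDITIONALLY ON THE SLICE `m⋆` yields a
`{∧₂,∨₂,0,1}` family of polynomially related size that strongly detects unconditionally. Mentions no general
circuit. -/
def SliceLift : Prop :=
  ∀ δ : ℝ, 0 < δ → δ < 1 / 2 → ∃ a : ℕ, ∀ M : (n : ℕ) → Circuit ((⊤ : SimpleGraph (Fin n)).edgeSet),
    (∀ᶠ n : ℕ in atTop, (M n).IsOver monotoneBasis) → Tendsto (sliceErrSum δ M) atTop (nhds 0) →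
      ∃ M' : (n : ℕ) → Circuit ((⊤ : SimpleGraph (Fin n)).edgeSet),
        (∀ᶠ n : ℕ in atTop, (M' n).IsOver monotoneBasis01 ∧ (M' n).size ≤ ((M n).size + n) ^ a) ∧
          Tendsto (errSum (kOf δ) M') atTop (nhds 0)

/-- **The reverse transport `PadSpec`** (routine twin of the landed `stub_transport`, NOT landed): a `B₂` family good
conditionally on the slice `m⋆` pads back (insert/delete ranked edges to reach `m⋆`) to a `B₂` family good
unconditionally, at additive polynomial size. -/
def PadSpec : Prop :=
  ∀ δ : ℝ, 0 < δ → δ < 1 / 2 → ∃ c : ℕ, ∀ M : (n : ℕ) → Circuit ((⊤ : SimpleGraph (Fin n)).edgeSet),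
    (∀ᶠ n : ℕ in atTop, (M n).IsOver B2) → Tendsto (sliceErrSum δ M) atTop (nhds 0) →
      ∃ C : (n : ℕ) → Circuit ((⊤ : SimpleGraph (Fin n)).edgeSet),
        (∀ᶠ n : ℕ in atTop, (C n).IsOver B2 ∧ (C n).size ≤ (M n).size + n ^ c) ∧
          Tendsto (errSum (kOf δ) C) atTop (nhds 0)

/-- Berkowitz on the transport slice, as a family statement (the block shared by all slice glues). [folklore] -/
theorem berkowitz_family (hBerk : Summit.PneNP.PneNP.Theses.OneSlice.SliceMonotonization) :
    ∃ c₀ : ℕ, ∀ (δ : ℝ) (C₁ : (n : ℕ) → Circuit ((⊤ : SimpleGraph (Fin n)).edgeSet)),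
      (∀ᶠ n : ℕ in atTop, (C₁ n).IsOver B2) → Tendsto (sliceErrSum δ C₁) atTop (nhds 0) →
        ∃ M₁ : (n : ℕ) → Circuit ((⊤ : SimpleGraph (Fin n)).edgeSet),
          (∀ᶠ n : ℕ in atTop, (M₁ n).IsOver monotoneBasis ∧ (M₁ n).size ≤ c₀ * ((C₁ n).size + n ^ c₀)) ∧
            Tendsto (sliceErrSum δ M₁) atTop (nhds 0) := by
  obtain ⟨c₀, hberk⟩ := hBerk
  refine ⟨c₀, fun δ C₁ hC₁ hC₁err => ?_⟩
  let P : ℕ → Prop := fun n => (C₁ n).IsOver B2 ∧ 0 < mStar n ∧ mStar n < n.choose 2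
  let M₁ : (n : ℕ) → Circuit ((⊤ : SimpleGraph (Fin n)).edgeSet) := fun n =>
    if h : P n then (hberk n (mStar n) (C₁ n) h.1 h.2.1 h.2.2).choose else C₁ n
  have hM₁ : ∀ᶠ n : ℕ in atTop, (M₁ n).IsOver monotoneBasis ∧
      (M₁ n).size ≤ c₀ * ((C₁ n).size + n ^ c₀) ∧
        ∀ x : EdgeVec n, eCount x = mStar n → (M₁ n).eval x = (C₁ n).eval x := by
    filter_upwards [hC₁, eventually_mStar] with n h1 h2
    have hP : P n := ⟨h1, h2⟩
    have hM : M₁ n = (hberk n (mStar n) (C₁ n) hP.1 hP.2.1 hP.2.2).choose := dif_pos hP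
    rw [hM]
    exact (hberk n (mStar n) (C₁ n) hP.1 hP.2.1 hP.2.2).choose_spec
  refine ⟨M₁, hM₁.mono fun n h => ⟨h.1, h.2.1⟩, ?_⟩
  refine (hC₁err).congr' ?_
  filter_upwards [hM₁] with n hn
  show sliceErrI n (mStar n) (C₁ n).eval + sliceErrII n (kOf δ n) (mStar n) (C₁ n).eval =
    sliceErrI n (mStar n) (M₁ n).eval + sliceErrII n (kOf δ n) (mStar n) (M₁ n).eval
  rw [sliceErrI_congr (fun x hx => (hn.2.2 x hx).symm), sliceErrII_congr (fun x hx => (hn.2.2 x hx).symm)]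

/-- **Glue of F3 (proved)**: `SliceLift`, the LANDED transport and Berkowitz give the crux. [folklore] -/
theorem monotoneSuffices_of_sliceLift (hL : SliceLift) (hT : TransportSpec)
    (hBerk : Summit.PneNP.PneNP.Theses.OneSlice.SliceMonotonization) : MonotoneSuffices := by
  intro δ hδ hδ'
  obtain ⟨a, ha⟩ := hL δ hδ hδ'
  obtain ⟨c₁, htrans⟩ := hT δ hδ hδ'
  obtain ⟨c₀, hberk⟩ := berkowitz_family hBerk
  refine ⟨(2 * c₀ + c₁ + 3 + 2) * a, fun s hyp => ?_⟩
  obtain ⟨C, hC, hCerr⟩ := hyp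
  obtain ⟨C₁, hC₁, hC₁err⟩ := htrans C (hC.mono fun n h => h.1) hCerr
  obtain ⟨M₁, hM₁, hM₁err⟩ := hberk δ C₁ (hC₁.mono fun n h => h.1) hC₁err
  obtain ⟨M', hM', hM'err⟩ := ha M₁ (hM₁.mono fun n h => h.1) hM₁err
  refine ⟨M', ?_, hM'err⟩
  filter_upwards [hM', hM₁, hC₁, hC, eventually_ge_atTop 2] with n h' h1 hc1 hc hn2
  refine ⟨h'.1, h'.2.trans ?_⟩
  have hsize : (M₁ n).size ≤ (s n + n) ^ (2 * c₀ + c₁ + 3) :=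
    (h1.2.trans (Nat.mul_le_mul_left _ (Nat.add_le_add_right
      (hc1.2.trans (Nat.add_le_add_right hc.2 _)) _))).trans (poly_absorb c₀ c₁ (s n) n hn2)
  calc ((M₁ n).size + n) ^ a ≤ ((s n + n) ^ (2 * c₀ + c₁ + 3) + n) ^ a :=
        Nat.pow_le_pow_left (Nat.add_le_add_right hsize n) a
    _ ≤ (s n + n) ^ ((2 * c₀ + c₁ + 3 + 2) * a) := pow_add_pow_le (s n) n _ a hn2

/-- **The only available converse goes through the crux**: `MonotoneSuffices` and the (routine, unlanded) reverse
transport `PadSpec` give `SliceLift` — so modulo the two transports `SliceLift` is the crux REWORDED in the monotone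
world, not a weaker piece. [folklore] -/
theorem sliceLift_of_monotoneSuffices (h : MonotoneSuffices) (hP : PadSpec) : SliceLift := by
  intro δ hδ hδ'
  obtain ⟨a, ha⟩ := h δ hδ hδ'
  obtain ⟨c, hc⟩ := hP δ hδ hδ'
  refine ⟨(c + 3) * a, fun M hM hMerr => ?_⟩
  obtain ⟨C, hC, hCerr⟩ :=
    hc M (hM.mono fun n h => h.mono fun g hg => deMorganBasis_subset_B2 (monotoneBasis_subset_deMorgan hg)) hMerr
  obtain ⟨M', hM', hM'err⟩ := ha (fun n => (M n).size + n ^ c) ⟨C, hC, hCerr⟩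
  refine ⟨M', ?_, hM'err⟩
  filter_upwards [hM', eventually_ge_atTop 2] with n hn hn2
  refine ⟨hn.1, hn.2.trans ?_⟩
  show ((M n).size + n ^ c + n) ^ a ≤ ((M n).size + n) ^ ((c + 3) * a)
  set q := (M n).size + n with hq
  have hq2 : 2 ≤ q := le_add_left hn2
  have hq1 : 1 ≤ q := by omega
  have hqc : q ≤ q ^ (c + 1) := by
    calc q = q ^ 1 := (pow_one q).symm
      _ ≤ q ^ (c + 1) := Nat.pow_le_pow_right hq1 (by omega)
  have hA : (M n).size ≤ q ^ (c + 1) := (Nat.le_add_right _ _).trans hqc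
  have hB : n ^ c ≤ q ^ (c + 1) :=
    (Nat.pow_le_pow_left (Nat.le_add_left n _) c).trans (Nat.pow_le_pow_right hq1 (by omega))
  have hC' : n ≤ q ^ (c + 1) := (Nat.le_add_left n _).trans hqc
  have h3 : 3 * q ^ (c + 1) ≤ q ^ (c + 3) := by
    have hqq : 3 ≤ q * q := by nlinarith
    calc 3 * q ^ (c + 1) ≤ (q * q) * q ^ (c + 1) := Nat.mul_le_mul_right _ hqq
      _ = q ^ (c + 3) := by ring
  have hsum : (M n).size + n ^ c + n ≤ q ^ (c + 3) := by
    calc (M n).size + n ^ c + n ≤ q ^ (c + 1) + q ^ (c + 1) + q ^ (c + 1) :=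
          Nat.add_le_add (Nat.add_le_add hA hB) hC'
      _ = 3 * q ^ (c + 1) := by ring
      _ ≤ q ^ (c + 3) := h3
  calc ((M n).size + n ^ c + n) ^ a ≤ (q ^ (c + 3)) ^ a := Nat.pow_le_pow_left hsum a
    _ = q ^ ((c + 3) * a) := by rw [← pow_mul]

/-! ### F4 — weak-then-amplify (`B₂ strong → monotone WEAK → monotone strong`) -/

/-- Weak monotone detection at exponent `δ` and budget `s`: a `{∧₂,∨₂,0,1}` family of size `≤ s n` whose planted
acceptance exceeds its null acceptance by `≥ 1/n^c` eventually. -/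
def WeakMono (δ : ℝ) (s : ℕ → ℕ) : Prop :=
  ∃ c : ℕ, ∃ M : (n : ℕ) → Circuit ((⊤ : SimpleGraph (Fin n)).edgeSet),
    (∀ᶠ n : ℕ in atTop, (M n).IsOver monotoneBasis01 ∧ (M n).size ≤ s n) ∧
      ∀ᶠ n : ℕ in atTop, (erdosRenyiHalf n).toOuterMeasure {x | (M n).eval x = true} + ((n : ENNReal) ^ c)⁻¹ ≤
        (plantedCliqueDist n (kOf δ n)).toOuterMeasure {x | (M n).eval x = true}

/-- **F4 piece 1, `WeakFromStrong`**: a small `B₂` STRONG detector yields a small monotone WEAK detector. -/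
def WeakFromStrong : Prop :=
  ∀ δ : ℝ, 0 < δ → δ < 1 / 2 → ∃ a : ℕ, ∀ s : ℕ → ℕ, HypB2 δ s → WeakMono δ (fun n => (s n + n) ^ a)

/-- **F4 piece 2, `MonoAmp`** (same-`δ` amplification inside the monotone world): a small monotone weak detector
yields a small monotone strong detector. -/
def MonoAmp : Prop :=
  ∀ δ : ℝ, 0 < δ → δ < 1 / 2 → ∃ a : ℕ, ∀ s : ℕ → ℕ, WeakMono δ s → ConclMono δ (fun n => (s n + n) ^ a)

/-- **Glue of F4 (proved)**: `WeakFromStrong → MonoAmp → MonotoneSuffices`. [folklore] -/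
theorem monotoneSuffices_of_weakSplit (h₁ : WeakFromStrong) (h₂ : MonoAmp) : MonotoneSuffices := by
  intro δ hδ hδ'
  obtain ⟨a₁, ha₁⟩ := h₁ δ hδ hδ'
  obtain ⟨a₂, ha₂⟩ := h₂ δ hδ hδ'
  refine ⟨(a₁ + 2) * a₂, fun s hyp => ?_⟩
  obtain ⟨M, hM, hMerr⟩ := ha₂ _ (ha₁ s hyp)
  refine ⟨M, ?_, hMerr⟩
  filter_upwards [hM, eventually_ge_atTop 2] with n hn hn2
  exact ⟨hn.1, hn.2.trans (pow_add_pow_le (s n) n a₁ a₂ hn2)⟩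

/-! ### F5 — the vacuity split (`QuasiPolyHardB2 ∧ BruteForce`), glue = the landed sandwich -/

/-- **Glue of F5 (landed)**: `QuasiPolyHardB2 → MonotoneSuffices` is `karlinRubin_monotoneSuffices_of_quasipolyHard`;
its open piece closes the summit alone (`pneNP_of_quasipolyHardB2`). [folklore] -/
theorem monotoneSuffices_of_quasipolyHardB2 (H : QuasiPolyHardB2) : MonotoneSuffices :=
  karlinRubin_monotoneSuffices_of_quasipolyHard H

/-- **Registered form** (stub `monotoneSuffices_iff_negationBudgetSplit` of stmt-PneNP-18026; `NegReduce`/`NegElim`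
unfolded): for every budget `b`, the crux is EQUIVALENT to the conjunction of its two negation-budget factors. [folklore] -/
theorem monotoneSuffices_iff_negationBudgetSplit :
    ∀ b : ℕ → ℕ, Summit.PneNP.PneNP.Theses.KarlinRubin.MonotoneSuffices ↔ ((∀ δ : ℝ, 0 < δ → δ < 1 / 2 → ∃ a : ℕ, ∀ s : ℕ → ℕ, (∃ C : (n : ℕ) → Circuit ((⊤ : SimpleGraph (Fin n)).edgeSet), (∀ᶠ n : ℕ in atTop, (C n).IsOver B2 ∧ (C n).size ≤ s n) ∧ Tendsto (fun n : ℕ => (erdosRenyiHalf n).toOuterMeasure {x | (C n).eval x = true} + (plantedCliqueDist n ⌈(n : ℝ) ^ (1 / 2 - δ)⌉₊).toOuterMeasure {x | (C n).eval x = false}) atTop (nhds 0)) → (∃ C : (n : ℕ) → Circuit ((⊤ : SimpleGraph (Fin n)).edgeSet), (∀ᶠ n : ℕ in atTop, (C n).IsOver deMorganBasis01 ∧ (C n).negationCount ≤ b n ∧ (C n).size ≤ (s n + n) ^ a) ∧ Tendsto (fun n : ℕ => (erdosRenyiHalf n).toOuterMeasure {x | (C n).eval x = true} + (plantedCliqueDist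 n ⌈(n : ℝ) ^ (1 / 2 - δ)⌉₊).toOuterMeasure {x | (C n).eval x = false}) atTop (nhds 0))) ∧ (∀ δ : ℝ, 0 < δ → δ < 1 / 2 → ∃ a : ℕ, ∀ s : ℕ → ℕ, (∃ C : (n : ℕ) → Circuit ((⊤ : SimpleGraph (Fin n)).edgeSet), (∀ᶠ n : ℕ in atTop, (C n).IsOver deMorganBasis01 ∧ (C n).negationCount ≤ b n ∧ (C n).size ≤ s n) ∧ Tendsto (fun n : ℕ => (erdosRenyiHalf n).toOuterMeasure {x | (C n).eval x = true} + (plantedCliqueDist n ⌈(n : ℝ) ^ (1 / 2 - δ)⌉₊).toOuterMeasure {x | (C n).eval x = false}) atTop (nhds 0)) → (∃ M : (n : ℕ) → Circuit ((⊤ : SimpleGraph (Fin n)).edgeSet), (∀ᶠ n : ℕ in atTop, (M n).IsOver monotoneBasis01 ∧ (M n).size ≤ (s n + n) ^ a) ∧ Tendsto (fun n : ℕ => (erdosRenyiHalf n).toOuterMeasure {x | (M n).eval x = true} + (plantedCliqueDist n ⌈(n : ℝ) ^ (1 / 2 - δ)⌉₊).toOuterMeasure {x | (M n).eval x = false}) atTop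 (nhds 0)))) :=
  fun b => monotoneSuffices_iff_negSplit b

end MonotoneSuffices.DecompCensus

end Summit.PneNP.PneNP.Theorems
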